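import Summits.QuantumFields.YangMills.Theorems.UnitScaleTiltProp8HalvingELMinimality
import Literature.MathematicalPhysics.QuantumFieldTheory.Balaban1983to89.BlockAveragingExpMeanLogContinuous
import Literature.Analysis.Matrix.DetExp
import HarnessLib

/-!
# Route `UnitScaleTilt`, crux K1 child «MinimiserStabilityRegPr» (stmt-QuantumFields-19200), registered stub V2′ `stub_halvingStep`
# (skeletons v8 5b4e846794b80374 ∕ v10 `BirthV10`) — **THE SU(2)-CHART HYPOTHESIS: KERNEL-CHECKED VACUITY WITNESS FOR THE OLD COMPETITOR SET AND
# SATISFIABILITY WITNESS FOR THE 𝔰𝔲(2) ONE** (owner RULING g26-№3, finding of record of this seat: negative ∕ positive knowledge behind the (R1)–(R3) wrappers)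

Cell `ym3-torus` (HUMAN RULING D-0037, YM ladder rung R3 — continuum SU(2) YM₃ on the torus is a RUNG, not the Clay problem), width seat
`ym-ust-19200-w7` gen 0 (D-0154 (3c)).  `--supports stmt-QuantumFields-19200 --as helper`; def-free, 0 sorry, standard axioms.

WHY.  RULING g26-№3 records that the chart hypothesis `hU : ∀ X ∈ T, ↑(U X b) = exp((I·η)•X(b)) ∈ SU(2)` of ✓ p604227 ∕ ✓ p605698 is unsatisfiable on
`T = {self-adjoint ∧ constraints ∧ S}` with `S` absorbing at the minimiser, and that the 𝔰𝔲(2) competitor set of ✓ p609568 ∕ ✓ p610894 (`T_𝔰𝔲`: bondwise traceless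
added) admits the chart.  THIS FILE makes both halves kernel facts: (i) along the test line `A + t·(s•1)` (`s` real, `s(b₀) ≠ 0`) an `SU(2)`-valued exponential chart is
IMPOSSIBLE — Liouville `det e^M = e^{tr M}` (`Literature.Analysis.Matrix.DetExp.det_exp_eq_exp_trace`) gives `e^{iη·tr A(b₀)}·e^{2iη·t·s(b₀)} = 1` for all small `t`, and a
complex exponential that is constant on an interval has zero logarithmic slope; instantiated at p604227's own competitor set this REFUTES the satisfiability of its `hU`
whenever `ker Q ∋ s ≠ 0`; (ii) on 𝔰𝔲(2)-valued fields the chart EXISTS: `X ↦ (b ↦ e^{iηX(b)})` is `SU(2)`-valued (`ExpMeanLog.exp_smul_mem_specialUnitaryGroup`).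

WHAT THIS FILE PROVES (no definition, no sorry):
* §1 `cexp_affine_const_imp` — if `t ↦ exp(c + t·k)` (complex) equals `1` for all `|t| < r`, `r > 0`, then `k = 0`;
  `trace_I_eta_smul_add_line` — `tr((Iη)•(M + t•(s•1))) = (Iη)·tr M + t·(2ηs·I)` in `M₂(ℂ)`.
* §2 ★★ **`no_su2Chart_on_line`** — for `η ≠ 0`, `s(b₀) ≠ 0`, NO map `U` into `SU(2)`-fields can satisfy `↑(U X b) = exp((Iη)•X b)` on a set containing the segment
  `{A + t·(s•1) : |t| < r}`; ★★ **`no_su2Chart_on_fatCompetitors`** — the instance at p604227's `T = {X | (∀ b, IsSelfAdjoint (X b)) ∧ (∀ c, Q_{j(c)}X(c) = B(c)) ∧ X ∈ S}` with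
  `A ∈ T`, `S` absorbing at `A`, `QE s = 0`, `s(b₀) ≠ 0` (the vacuity witness of record).
* §3 ★ **`exists_su2Chart`** — `∃ U : (bonds → M₂(ℂ)) → SU(2)-fields, ∀ Y bondwise self-adjoint AND traceless, ∀ b, ↑(U Y b) = exp((Iη)•Y b)` (the chart `T_𝔰𝔲` admits; for the
  dressed chart take `Y := X − H(D X)`).
HONEST SCOPE.  Elementary (Liouville's formula, one derivative); documents the finding, changes no consumer.  NOT a claim about the stub, the crux, the rung or the mass gap.

References: T. Bałaban, CMP **102** (1985) 277–309 [Balaban1985Variational] (5) p.278 (SU(2) fields), (126)–(127) p.297 (𝔤-valued variations), (150) p.301; B. C. Hall,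
*Lie Groups, Lie Algebras, and Representations* (2015) Thm 2.12 (`det e^X = e^{tr X}`).
-/

set_option autoImplicit false

noncomputable section

open scoped BigOperators Matrix.Norms.L2Operator Topology
open NormedSpace

namespace Summit.QuantumFields.YangMills.Theorems.HalvingSU2ChartWitness

open Literature.MathematicalPhysics.QuantumFieldTheory.Balaban1983to89
open B6SectADomainsV1 (Domains)
open B6SectAOperatorsV1 (BondIdx QE QE_apply)
open LatticeFieldCalculus (bondAvgIter)
open Literature.MathematicalPhysics.QuantumFieldTheory.BalabanImbrieJaffe1984to88.BIJ85AxialPropagator411 (bondAvgIter_add bondAvgIter_smul)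
open Literature.Analysis.Matrix (det_exp_eq_exp_trace)
open ExpMeanLog (exp_smul_mem_specialUnitaryGroup)

/-! ## §1 Two scalar facts -/

section Scalar

/-- **A COMPLEX EXPONENTIAL CONSTANT ON AN INTERVAL HAS ZERO SLOPE**: if `exp(c + t·k) = 1` for all real `|t| < r` (`r > 0`) then `k = 0`. [folklore] -/
theorem cexp_affine_const_imp {c k : ℂ} {r : ℝ} (hr : 0 < r) (h : ∀ t : ℝ, |t| < r → Complex.exp (c + (t : ℂ) * k) = 1) : k = 0 := by
  -- the derivative of `t ↦ exp(c + t·k)` at `0` is `exp(c)·k`; the function is `1` near `0`, so the derivative is also `0`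
  have hg : HasDerivAt (fun t : ℝ => c + (t : ℂ) * k) k 0 := by
    have h1 : HasDerivAt (fun z : ℂ => c + z * k) k ((0 : ℝ) : ℂ) := by
      simpa using ((hasDerivAt_id ((0 : ℝ) : ℂ)).mul_const k).const_add c
    exact h1.comp_ofReal
  have hf : HasDerivAt (fun t : ℝ => Complex.exp (c + (t : ℂ) * k)) (Complex.exp (c + ((0 : ℝ) : ℂ) * k) * k) 0 :=
    (Complex.hasDerivAt_exp _).comp (0 : ℝ) hg
  have hconst : (fun t : ℝ => Complex.exp (c + (t : ℂ) * k)) =ᶠ[𝓝 (0 : ℝ)] fun _ => (1 : ℂ) := by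
    filter_upwards [Metric.ball_mem_nhds (0 : ℝ) hr] with t ht
    rw [Metric.mem_ball, dist_zero_right, Real.norm_eq_abs] at ht
    exact h t ht
  have hf0 : HasDerivAt (fun t : ℝ => Complex.exp (c + (t : ℂ) * k)) 0 0 := (hasDerivAt_const (0 : ℝ) (1 : ℂ)).congr_of_eventuallyEq hconst
  have huniq := hf.unique hf0
  rcases mul_eq_zero.1 huniq with h0 | h0
  · exact absurd h0 (Complex.exp_ne_zero _)
  · exact h0

/-- `tr((Iη)•(M + t•(s•1))) = (Iη)·tr M + t·(2ηs·I)` in `M₂(ℂ)` (`tr 1 = 2`). [folklore] -/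
theorem trace_I_eta_smul_add_line (η s t : ℝ) (M : Matrix (Fin 2) (Fin 2) ℂ) :
    Matrix.trace ((Complex.I * (η : ℂ)) • (M + t • (((s : ℝ) : ℂ) • (1 : Matrix (Fin 2) (Fin 2) ℂ)))) =
      Complex.I * (η : ℂ) * Matrix.trace M + (t : ℂ) * (2 * (η : ℂ) * (s : ℂ) * Complex.I) := by
  rw [Matrix.trace_smul, Matrix.trace_add, Matrix.trace_smul, Matrix.trace_smul, Matrix.trace_one, Fintype.card_fin, smul_eq_mul, Complex.real_smul]
  push_cast
  ring

end Scalar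

/-! ## §2 No `SU(2)`-valued exponential chart along a trace line -/

section Vacuity

variable {P : Params}

/-- ★★ **NO `SU(2)`-VALUED EXPONENTIAL CHART ALONG THE TEST LINE `A + t·(s•1)`**: if `η ≠ 0`, `s(b₀) ≠ 0` and a set `T` of `M₂(ℂ)`-valued fields contains `A + t·(s•1)` for all
`|t| < r` (`r > 0`), then no `U : (bonds → M₂(ℂ)) → SU(2)-fields` has `↑(U X b) = exp((Iη)•X(b))` for all `X ∈ T` — `det exp = exp tr` forces `exp(2iη·t·s(b₀))` to be constant.
[cite: Balaban1985Variational, (5) p.278, (126)-(127) p.297] -/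
theorem no_su2Chart_on_line (η : ℝ) (hη : η ≠ 0) {T : Set (PBond P 0 → Matrix (Fin 2) (Fin 2) ℂ)} {A : PBond P 0 → Matrix (Fin 2) (Fin 2) ℂ}
    {s : PBond P 0 → ℝ} {b₀ : PBond P 0} (hs : s b₀ ≠ 0) {r : ℝ} (hr : 0 < r)
    (hT : ∀ t : ℝ, |t| < r → (A + t • fun b => ((s b : ℝ) : ℂ) • (1 : Matrix (Fin 2) (Fin 2) ℂ)) ∈ T)
    (U : (PBond P 0 → Matrix (Fin 2) (Fin 2) ℂ) → GaugeField P 0 (Matrix.specialUnitaryGroup (Fin 2) ℂ))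
    (hU : ∀ X ∈ T, ∀ b, ((U X b : Matrix.specialUnitaryGroup (Fin 2) ℂ) : Matrix (Fin 2) (Fin 2) ℂ) = exp ((Complex.I * (η : ℂ)) • X b)) : False := by
  -- along the line, `det ↑(U X_t b₀) = 1` reads `exp(Iη·tr A(b₀) + t·(2ηs(b₀)·I)) = 1`
  have hline : ∀ t : ℝ, |t| < r →
      Complex.exp (Complex.I * (η : ℂ) * Matrix.trace (A b₀) + (t : ℂ) * (2 * (η : ℂ) * (s b₀ : ℂ) * Complex.I)) = 1 := by
    intro t ht
    have hmem := (U (A + t • fun b => ((s b : ℝ) : ℂ) • (1 : Matrix (Fin 2) (Fin 2) ℂ)) b₀).2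
    rw [Matrix.mem_specialUnitaryGroup_iff] at hmem
    have hdet := hmem.2
    rw [hU _ (hT t ht) b₀, det_exp_eq_exp_trace, ← Complex.exp_eq_exp_ℂ] at hdet
    have htr : Matrix.trace ((Complex.I * (η : ℂ)) • (A + t • fun b => ((s b : ℝ) : ℂ) • (1 : Matrix (Fin 2) (Fin 2) ℂ)) b₀) =
        Complex.I * (η : ℂ) * Matrix.trace (A b₀) + (t : ℂ) * (2 * (η : ℂ) * (s b₀ : ℂ) * Complex.I) := by
      rw [show (A + t • fun b => ((s b : ℝ) : ℂ) • (1 : Matrix (Fin 2) (Fin 2) ℂ)) b₀ = A b₀ + t • (((s b₀ : ℝ) : ℂ) • (1 : Matrix (Fin 2) (Fin 2) ℂ)) from rfl]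
      exact trace_I_eta_smul_add_line η (s b₀) t (A b₀)
    rw [htr] at hdet
    exact hdet
  have hk := cexp_affine_const_imp hr hline
  -- `2ηs(b₀)·I = 0` contradicts `η ≠ 0`, `s(b₀) ≠ 0`
  have : (2 * (η : ℂ) * (s b₀ : ℂ) * Complex.I) ≠ 0 := by
    refine mul_ne_zero (mul_ne_zero (mul_ne_zero two_ne_zero ?_) ?_) Complex.I_ne_zero
    · exact_mod_cast hη
    · exact_mod_cast hs
  exact this hk

/-- ★★ **THE VACUITY WITNESS OF RECORD** (owner RULING g26-№3): at ✓ p604227's competitor set `T = {X | X bondwise self-adjoint ∧ (∀ c, Q_{j(c)}X(c) = B(c)) ∧ X ∈ S}` with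
`S` absorbing at the (self-adjoint, constrained) `A` in every direction, and a real `s ∈ ker Q` with `s(b₀) ≠ 0`, its chart hypothesis `∀ X ∈ T, ↑(U X b) = exp((Iη)•X(b))` (`U` `SU(2)`-valued,
`η ≠ 0`) is UNSATISFIABLE — the segment `A + t·(s•1)` lies in `T`. [cite: Balaban1985Variational, (126)-(127) p.297, (150) p.301] -/
theorem no_su2Chart_on_fatCompetitors (D : Domains P) (η : ℝ) (hη : η ≠ 0) {S : Set (PBond P 0 → Matrix (Fin 2) (Fin 2) ℂ)}
    {Bdat : BondIdx D → Matrix (Fin 2) (Fin 2) ℂ} {A : PBond P 0 → Matrix (Fin 2) (Fin 2) ℂ}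
    (hAsa : ∀ b, IsSelfAdjoint (A b)) (hAQ : ∀ c : BondIdx D, bondAvgIter (c.1.1 : ℕ) A c.1.2 = Bdat c)
    (hS : ∀ δ : PBond P 0 → Matrix (Fin 2) (Fin 2) ℂ, ∃ r : ℝ, 0 < r ∧ ∀ t : ℝ, |t| < r → A + t • δ ∈ S)
    {s : PBond P 0 → ℝ} (hsQ : QE D (WithLp.toLp 2 s) = 0) {b₀ : PBond P 0} (hs : s b₀ ≠ 0)
    (U : (PBond P 0 → Matrix (Fin 2) (Fin 2) ℂ) → GaugeField P 0 (Matrix.specialUnitaryGroup (Fin 2) ℂ))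
    (hU : ∀ X ∈ {X : PBond P 0 → Matrix (Fin 2) (Fin 2) ℂ | (∀ b, IsSelfAdjoint (X b)) ∧ (∀ c : BondIdx D, bondAvgIter (c.1.1 : ℕ) X c.1.2 = Bdat c) ∧ X ∈ S},
      ∀ b, ((U X b : Matrix.specialUnitaryGroup (Fin 2) ℂ) : Matrix (Fin 2) (Fin 2) ℂ) = exp ((Complex.I * (η : ℂ)) • X b)) : False := by
  set δ : PBond P 0 → Matrix (Fin 2) (Fin 2) ℂ := fun b => ((s b : ℝ) : ℂ) • (1 : Matrix (Fin 2) (Fin 2) ℂ) with hδdef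
  obtain ⟨r, hr, hSr⟩ := hS δ
  have hQs : ∀ c : BondIdx D, bondAvgIter (c.1.1 : ℕ) s c.1.2 = 0 := fun c => by
    have h := congrArg (fun v : B6SectAOperatorsV1.BondIdxSpace D => v c) hsQ
    simpa [QE_apply] using h
  have hδφ : δ = fun b => (LinearMap.toSpanSingleton ℝ (Matrix (Fin 2) (Fin 2) ℂ) 1) (s b) := by
    funext b
    show ((s b : ℝ) : ℂ) • (1 : Matrix (Fin 2) (Fin 2) ℂ) = (LinearMap.toSpanSingleton ℝ (Matrix (Fin 2) (Fin 2) ℂ) 1) (s b)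
    rw [LinearMap.toSpanSingleton_apply, Complex.coe_smul]
  -- the segment `A + t·(s•1)` stays in the fat competitor set (same bookkeeping as p604227, `E := 1`)
  have hT : ∀ t : ℝ, |t| < r →
      A + t • δ ∈ {X : PBond P 0 → Matrix (Fin 2) (Fin 2) ℂ | (∀ b, IsSelfAdjoint (X b)) ∧ (∀ c : BondIdx D, bondAvgIter (c.1.1 : ℕ) X c.1.2 = Bdat c) ∧ X ∈ S} := by
    intro t ht
    refine ⟨fun b => ?_, fun c => ?_, hSr t ht⟩
    · show IsSelfAdjoint (A b + t • (((s b : ℝ) : ℂ) • (1 : Matrix (Fin 2) (Fin 2) ℂ)))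
      rw [Complex.coe_smul]
      exact (hAsa b).add (IsSelfAdjoint.smul (IsSelfAdjoint.all t) (IsSelfAdjoint.smul (IsSelfAdjoint.all (s b)) (IsSelfAdjoint.one _)))
    · rw [bondAvgIter_add, bondAvgIter_smul, Pi.add_apply, Pi.smul_apply, hAQ c, hδφ,
        ChartHInv.bondAvgIter_comp_apply (LinearMap.toSpanSingleton ℝ (Matrix (Fin 2) (Fin 2) ℂ) 1) (c.1.1 : ℕ) s c.1.2, hQs c, map_zero, smul_zero, add_zero]
  exact no_su2Chart_on_line η hη hs hr hT U hU

end Vacuity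

/-! ## §3 The 𝔰𝔲(2) competitor set admits the chart -/

section Witness

variable {P : Params}

/-- ★ **THE CHART EXISTS ON 𝔰𝔲(2)-VALUED FIELDS**: there is `U : (bonds → M₂(ℂ)) → SU(2)-fields` with `↑(U Y b) = exp((Iη)•Y(b))` at every bond of every bondwise
self-adjoint TRACELESS `Y` — so the chart hypothesis of `HalvingELMinimalitySU2.tracePairing_of_isMinOn_su2` (and, with `Y := X − H(D X)`, of
`HalvingDressedCriticalitySU2.tracePairing_of_isMinOn_dressed_wilson_su2`) is SATISFIABLE on `T_𝔰𝔲`. [cite: Balaban1985Variational, (5) p.278; Balaban1987RG1, (0.9) p.253] -/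
theorem exists_su2Chart (η : ℝ) :
    ∃ U : (PBond P 0 → Matrix (Fin 2) (Fin 2) ℂ) → GaugeField P 0 (Matrix.specialUnitaryGroup (Fin 2) ℂ),
      ∀ Y : PBond P 0 → Matrix (Fin 2) (Fin 2) ℂ, (∀ b, IsSelfAdjoint (Y b)) → (∀ b, Matrix.trace (Y b) = 0) →
        ∀ b, ((U Y b : Matrix.specialUnitaryGroup (Fin 2) ℂ) : Matrix (Fin 2) (Fin 2) ℂ) = exp ((Complex.I * (η : ℂ)) • Y b) := by
  classical
  -- membership for 𝔰𝔲(2) data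
  have hmem : ∀ M : Matrix (Fin 2) (Fin 2) ℂ, IsSelfAdjoint M → Matrix.trace M = 0 →
      exp ((Complex.I * (η : ℂ)) • M) ∈ Matrix.specialUnitaryGroup (Fin 2) ℂ := by
    intro M hM htr
    have hskew : star (Complex.I • M) = -(Complex.I • M) := by
      rw [star_smul, Complex.star_def, Complex.conj_I, hM.star_eq, neg_smul]
    have htr' : (Complex.I • M).trace = 0 := by rw [Matrix.trace_smul, htr, smul_zero]
    have h := exp_smul_mem_specialUnitaryGroup hskew htr' η
    rwa [smul_smul, mul_comm] at h
  refine ⟨fun Y b => if h : IsSelfAdjoint (Y b) ∧ Matrix.trace (Y b) = 0 then ⟨exp ((Complex.I * (η : ℂ)) • Y b), hmem _ h.1 h.2⟩ else 1, ?_⟩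
  intro Y hsa htr b
  simp only [dif_pos (And.intro (hsa b) (htr b))]

end Witness

end Summit.QuantumFields.YangMills.Theorems.HalvingSU2ChartWitness

end
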